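import Mathlib.MeasureTheory.Measure.Haar.Basic
import Mathlib.MeasureTheory.Group.Integral
import Mathlib.MeasureTheory.Function.LocallyIntegrable
import Mathlib.MeasureTheory.Integral.Bochner.Set
import Literature.NumberTheory.Automorphic.SmoothInduction
import Literature.NumberTheory.Automorphic.WhittakerTwistedJacquet
import Literature.NumberTheory.Automorphic.UnitaryGroupUnipotentLimitCompactOpen
import HarnessLib

/-!
# The open-cell Haar functional on a smoothly induced representation: non-vanishing of Jacquet-module classes

Topic `NumberTheory/Automorphic`; namespace `Literature.NumberTheory.Automorphic`.  THEOREMS ONLY: no definition, no named fact,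
no `sorry`, no instance, no notation.
Registry pub/hodgecm-mathlib F0∕P3, line `F0_P3_KeysCaseTwoPaydown`, node N1 (★ `UnitaryGroup.U3PrincipalSeriesJacquetFiltration`,
[Casselman1995, Lemma 7.1.1 (a)]) — the LOWER-BOUND half «the open Bruhat cell contributes a NON-ZERO class to the Jacquet module».

## The mathematics ([BernsteinZelevinsky1977, §5 (open orbit of the Geometrical Lemma 2.12), Prop. 1.9 (a)]; [Casselman1995, §6.3])

`H ≤ G` topological groups, `σ` a representation of `H` on a Banach space `W`, `Ind_H^G σ` the smooth induction (★ `Representation.SmoothInd`: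
LEFT `H`-equivariant functions, RIGHT translation action), `w₀ ∈ G`, `ι : Γ →* G` continuous with `Γ` the union of its compact open
subgroups (★ `IsLimitOfCompactOpen`; in the application `Γ = N`, `H = P`, `w₀` a Weyl representative, `P w₀ N` the open cell).  The **cell
function** `γ ↦ f (w₀ ι(γ))` (§2) is locally constant; on the `Γ`-stable subspace of the `f` with compactly supported cell function the
Bochner integral `λ(f) = ∫ f (w₀ ι(γ)) dμ(γ)` against a RIGHT-invariant measure finite on compacts is a `Γ`-invariant linear functional
(§3).  A `Γ`-invariant functional on a `Γ`-stable subspace kills the vectors whose class in the coinvariants of the WHOLE representation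
vanishes (§1, ★ `Representation.coinvariantsMap_injective_of_isLimitOfCompactOpen`), so `λ(f) ≠ 0 ⟹ [f] ≠ 0`; in particular a section with
cell function `1_K · w` (`K ⊆ Γ` non-empty compact open, `w ≠ 0`) has a non-zero class (right Haar measure chosen inside the proof).  §4: the
Jacquet-module carrier `(t.restrict ρ).Coinvariants` of a ★ `ParabolicTriple` for `Ind_P^G σ'` ∕ ★ `normalizedInd`; §5: ★ `cmBorelTriple L N v`,
★ `cmPrincipalSeries` (★ `isLimitOfCompactOpen_cmBorelTriple_N`).  `w₀` is arbitrary: no Bruhat decomposition enters the non-vanishing.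
HC_CM is proved only modulo the printed citations until rung 0 closes; this file alone discharges no named fact (one half of N1).

## References
* [BernsteinZelevinsky1977] I. N. Bernstein, A. V. Zelevinsky, *Induced representations of reductive `p`-adic groups. I*,
  Ann. Sci. ÉNS (4) 10 (1977), Prop. 1.9 (a), §2.3, Geometrical Lemma 2.12 and §5 (Thm. 5.2).
* [Casselman1995] W. Casselman, *Introduction to the theory of admissible representations of `p`-adic reductive groups*
  (draft 1 May 1995), Prop. 3.2.3, §6.3 (Thm. 6.3.5), Lemma 7.1.1 (a).
-/

set_option autoImplicit false

noncomputable section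

open MeasureTheory
open scoped Pointwise MatrixGroups

/-! ## §1 A `Γ`-invariant functional on a `Γ`-stable subspace detects non-zero coinvariant classes -/

namespace Representation

open Literature.NumberTheory.Automorphic

variable {k Γ V M : Type*} [Field k] [CharZero k] [Group Γ] [TopologicalSpace Γ] [IsTopologicalGroup Γ]
  [AddCommGroup V] [Module k V] [AddCommGroup M] [Module k M] {ρ : Representation k Γ V}

/-- **An invariant functional on a stable subspace kills the subspace's vectors with vanishing coinvariant class** (left
exactness of coinvariants, [BernsteinZelevinsky1977, Prop. 1.9 (a)]): `Γ` the union of its compact open subgroups, `ρ` smooth over a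
field of characteristic `0`, `S ≤ V` `Γ`-stable, `λ : S → M` linear with `λ (ρ γ v) = λ v` on `S`; if `v ∈ S` has class `[v] = 0` in the
coinvariants of the WHOLE representation then `λ v = 0` (`S_Γ ↪ V_Γ` by ★ `coinvariantsMap_injective_of_isLimitOfCompactOpen`, and `λ`
factors through `S_Γ`). [cite: BernsteinZelevinsky1977, Prop. 1.9 (a)] -/
theorem apply_eq_zero_of_mk_coinvariants_eq_zero (hΓ : IsLimitOfCompactOpen Γ) (hρ : ρ.IsSmooth)
    (S : Submodule k V) (hS : ∀ (γ : Γ) ⦃v : V⦄, v ∈ S → ρ γ v ∈ S) (lam : S →ₗ[k] M)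
    (hlam : ∀ (γ : Γ) (v : S), lam ⟨ρ γ v, hS γ v.2⟩ = lam v) (v : S)
    (hv : Coinvariants.mk ρ (v : V) = 0) : lam v = 0 := by
  -- the sub-representation on `S` and its injective inclusion
  let ρS : Subrepresentation ρ := ⟨S, hS⟩
  let f : ρS.toRepresentation.IntertwiningMap ρ :=
    { toLinearMap := S.subtype
      isIntertwining' := fun γ => by ext w; rfl }
  have hf : Function.Injective f := Subtype.val_injective
  have hinj := coinvariantsMap_injective_of_isLimitOfCompactOpen hΓ hρ f hf
  -- `[v]_S ↦ [v] = 0`, so `[v]_S = 0`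
  have hvS : Coinvariants.mk ρS.toRepresentation v = 0 := by
    apply hinj
    rw [Coinvariants.map_mk, map_zero]
    exact hv
  -- `λ` factors through `S_Γ`
  have hlin : ∀ γ : Γ, lam ∘ₗ ρS.toRepresentation γ = lam := fun γ => by
    ext w
    exact hlam γ w
  have h := congrArg (Coinvariants.lift ρS.toRepresentation lam hlin) hvS
  rwa [Coinvariants.lift_mk, map_zero] at h

/-- Contrapositive: **a `Γ`-invariant functional on a `Γ`-stable subspace not vanishing at `v ∈ S` shows `[v] ≠ 0` in the coinvariants
of the whole representation**. [cite: BernsteinZelevinsky1977, Prop. 1.9 (a)] -/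
theorem mk_coinvariants_ne_zero_of_apply_ne_zero (hΓ : IsLimitOfCompactOpen Γ) (hρ : ρ.IsSmooth)
    (S : Submodule k V) (hS : ∀ (γ : Γ) ⦃v : V⦄, v ∈ S → ρ γ v ∈ S) (lam : S →ₗ[k] M)
    (hlam : ∀ (γ : Γ) (v : S), lam ⟨ρ γ v, hS γ v.2⟩ = lam v) (v : S) (hv : lam v ≠ 0) :
    Coinvariants.mk ρ (v : V) ≠ 0 :=
  fun h => hv (apply_eq_zero_of_mk_coinvariants_eq_zero hΓ hρ S hS lam hlam v h)

end Representation

namespace Literature.NumberTheory.Automorphic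

/-! ## §2 The cell function `γ ↦ f (w₀ ι(γ))` of an induced vector -/

section Cell

variable {G : Type*} [Group G] [TopologicalSpace G] [IsTopologicalGroup G] {H : Subgroup G} {W : Type*} [AddCommGroup W]
  [Module ℂ W] {σ : Representation ℂ H W} {Γ : Type*} [Group Γ] (ι : Γ →* G) (w₀ : G)

/-- **right translation by `ι(γ₀)` translates the cell function** `γ ↦ f (w₀ ι(γ))` of `f ∈ Ind_H^G σ` (★ `Representation.SmoothInd`,
`(g · f)(x) = f (x g)`): the cell function of `ι(γ₀) · f` is `γ ↦ f (w₀ ι(γ γ₀))`. [cite: BernsteinZelevinsky1977, §5 (5.1)] -/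
theorem SmoothInd.cellFun_smoothIndRep (γ₀ : Γ) (f : Representation.SmoothInd H σ) :
    (fun γ => (Representation.smoothIndRep H σ (ι γ₀) f).toFun (w₀ * ι γ)) = fun γ => f.toFun (w₀ * ι (γ * γ₀)) := by
  funext γ
  simp only [Representation.toFun_smoothIndRep_apply, map_mul, mul_assoc]

variable [TopologicalSpace Γ] [IsTopologicalGroup Γ]

/-- **the cell function of a smooth induced vector is locally constant** (`f` is fixed under right translation by an open subgroup
`K_f ≤ G`, so `γ ↦ f (w₀ ι(γ))` is constant on the cosets `γ · ι⁻¹(K_f)`). [cite: BernsteinZelevinsky1977, §2.3 and §5] -/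
theorem SmoothInd.isLocallyConstant_cellFun (hι : Continuous ι) (f : Representation.SmoothInd H σ) :
    IsLocallyConstant fun γ => f.toFun (w₀ * ι γ) := by
  rw [IsLocallyConstant.iff_exists_open]
  intro γ
  have hopen : IsOpen (((Representation.smoothIndRep H σ).stabilizerSubgroup f).comap ι : Set Γ) :=
    (Representation.isSmooth_smoothInd H σ f).preimage hι
  refine ⟨(fun γ' => γ * γ') '' (((Representation.smoothIndRep H σ).stabilizerSubgroup f).comap ι : Set Γ),
    (Homeomorph.mulLeft γ).isOpenMap _ hopen, ⟨1, Subgroup.one_mem _, mul_one γ⟩, ?_⟩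
  rintro _ ⟨κ, hκ, rfl⟩
  have hfix : Representation.smoothIndRep H σ (ι κ) f = f := by
    simpa only [SetLike.mem_coe, Subgroup.mem_comap, Representation.mem_stabilizerSubgroup] using hκ
  have h := congrArg (fun f' : Representation.SmoothInd H σ => f'.toFun (w₀ * ι γ)) hfix
  simp only [Representation.toFun_smoothIndRep_apply] at h
  simp only [map_mul, ← mul_assoc]
  exact h

/-- compact support of the cell function is preserved by right translation by `ι(γ₀)`. [cite: BernsteinZelevinsky1977, §5 (5.1)] -/
theorem SmoothInd.hasCompactSupport_cellFun_smoothIndRep (γ₀ : Γ) {f : Representation.SmoothInd H σ}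
    (hf : HasCompactSupport fun γ => f.toFun (w₀ * ι γ)) :
    HasCompactSupport fun γ => (Representation.smoothIndRep H σ (ι γ₀) f).toFun (w₀ * ι γ) := by
  rw [SmoothInd.cellFun_smoothIndRep]
  exact hf.comp_homeomorph (Homeomorph.mulRight γ₀)

end Cell

/-! ## §3 The Haar functional `λ(f) = ∫ f (w₀ ι(γ)) dμ(γ)` and the non-vanishing of classes -/

section Functional

variable {G : Type*} [Group G] [TopologicalSpace G] [IsTopologicalGroup G] (H : Subgroup G)
  {W : Type*} [NormedAddCommGroup W] [NormedSpace ℂ W] (σ : Representation ℂ H W)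
  {Γ : Type*} [Group Γ] [TopologicalSpace Γ] [IsTopologicalGroup Γ] [MeasurableSpace Γ] [BorelSpace Γ]
  (ι : Γ →* G) (w₀ : G) (μ : Measure Γ) [IsFiniteMeasureOnCompacts μ]

omit [MeasurableSpace Γ] [BorelSpace Γ] in
/-- the cell function of a smooth induced vector is continuous (it is locally constant). [cite: BernsteinZelevinsky1977, §2.3 and §5] -/
theorem SmoothInd.continuous_cellFun (hι : Continuous ι) (f : Representation.SmoothInd H σ) :
    Continuous fun γ => f.toFun (w₀ * ι γ) :=
  (SmoothInd.isLocallyConstant_cellFun ι w₀ hι f).continuous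

/-- a compactly supported cell function is integrable against any measure finite on compacts. [cite: Casselman1995, §6.3 (proof of Thm. 6.3.5)] -/
theorem SmoothInd.integrable_cellFun (hι : Continuous ι) {f : Representation.SmoothInd H σ}
    (hf : HasCompactSupport fun γ => f.toFun (w₀ * ι γ)) : Integrable (fun γ => f.toFun (w₀ * ι γ)) μ :=
  (SmoothInd.continuous_cellFun H σ ι w₀ hι f).integrable_of_hasCompactSupport hf

omit [IsFiniteMeasureOnCompacts μ] in
/-- **`Γ`-invariance of the Haar functional** `λ(f) = ∫ f (w₀ ι(γ)) dμ(γ)` for a RIGHT-invariant `μ`: `λ(ι(γ₀) · f) = λ(f)` (substitution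
`γ ↦ γ γ₀`, Mathlib `integral_mul_right_eq_self`). [cite: Casselman1995, §6.3 (proof of Thm. 6.3.5)] -/
theorem SmoothInd.integral_cellFun_smoothIndRep [μ.IsMulRightInvariant] (γ₀ : Γ) (f : Representation.SmoothInd H σ) :
    ∫ γ, (Representation.smoothIndRep H σ (ι γ₀) f).toFun (w₀ * ι γ) ∂μ = ∫ γ, f.toFun (w₀ * ι γ) ∂μ := by
  rw [show (fun γ => (Representation.smoothIndRep H σ (ι γ₀) f).toFun (w₀ * ι γ)) = fun γ => f.toFun (w₀ * ι (γ * γ₀)) from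
    SmoothInd.cellFun_smoothIndRep ι w₀ γ₀ f]
  exact integral_mul_right_eq_self (fun γ => f.toFun (w₀ * ι γ)) γ₀

/-- **THE OPEN-CELL NON-VANISHING CRITERION** ([BernsteinZelevinsky1977, §5]; [Casselman1995, §6.3]): `Γ` the union of its compact open
subgroups, `ι : Γ →* G` continuous, `μ` a right-invariant measure on `Γ` finite on compacts, `f ∈ Ind_H^G σ` with compactly supported cell
function and `∫ f (w₀ ι(γ)) dμ(γ) ≠ 0` ⟹ the class of `f` in the `Γ`-coinvariants of `Ind_H^G σ ∘ ι` is NON-ZERO.  (§1 applied to the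
`Γ`-stable subspace of the `f` with compactly supported cell function and the linear functional `f ↦ ∫ f (w₀ ι(γ)) dμ(γ)` on it.)
[cite: BernsteinZelevinsky1977, Prop. 1.9 (a) and §5 (5.2)] [cite: Casselman1995, §6.3 (proof of Thm. 6.3.5)] -/
theorem SmoothInd.mk_coinvariants_ne_zero_of_integral_cellFun_ne_zero [μ.IsMulRightInvariant]
    (hΓ : IsLimitOfCompactOpen Γ) (hι : Continuous ι) (f : Representation.SmoothInd H σ)
    (hf : HasCompactSupport fun γ => f.toFun (w₀ * ι γ)) (hint : ∫ γ, f.toFun (w₀ * ι γ) ∂μ ≠ 0) :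
    Representation.Coinvariants.mk ((Representation.smoothIndRep H σ).comp ι) f ≠ 0 := by
  -- the `Γ`-stable subspace of vectors with compactly supported cell function
  let S : Submodule ℂ (Representation.SmoothInd H σ) :=
    { carrier := {f | HasCompactSupport fun γ => f.toFun (w₀ * ι γ)}
      zero_mem' := HasCompactSupport.of_support_subset_isCompact isCompact_empty (fun γ hγ => hγ rfl)
      add_mem' := fun {f g} hf hg => by
        change HasCompactSupport fun γ => (f + g).toFun (w₀ * ι γ)
        simp only [Representation.SmoothInd.toFun_add, Pi.add_apply]
        exact hf.add hg
      smul_mem' := fun c f hf => by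
        change HasCompactSupport fun γ => (c • f).toFun (w₀ * ι γ)
        simp only [Representation.SmoothInd.toFun_smul, Pi.smul_apply]
        exact hf.smul_left }
  have hS : ∀ (γ : Γ) ⦃f : Representation.SmoothInd H σ⦄, f ∈ S → ((Representation.smoothIndRep H σ).comp ι) γ f ∈ S :=
    fun γ _ hv => SmoothInd.hasCompactSupport_cellFun_smoothIndRep ι w₀ γ hv
  -- the Haar functional on it
  let lam : S →ₗ[ℂ] W :=
    { toFun := fun f => ∫ γ, (f : Representation.SmoothInd H σ).toFun (w₀ * ι γ) ∂μ
      map_add' := fun f g => by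
        simp only [Submodule.coe_add, Representation.SmoothInd.toFun_add, Pi.add_apply]
        exact integral_add (SmoothInd.integrable_cellFun H σ ι w₀ μ hι f.2) (SmoothInd.integrable_cellFun H σ ι w₀ μ hι g.2)
      map_smul' := fun c f => by
        simp only [Submodule.coe_smul, Representation.SmoothInd.toFun_smul, Pi.smul_apply, RingHom.id_apply]
        exact integral_smul c _ }
  have hlam : ∀ (γ : Γ) (f : S), lam ⟨((Representation.smoothIndRep H σ).comp ι) γ f, hS γ f.2⟩ = lam f :=
    fun γ f => SmoothInd.integral_cellFun_smoothIndRep H σ ι w₀ μ γ (f : Representation.SmoothInd H σ)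
  exact Representation.mk_coinvariants_ne_zero_of_apply_ne_zero hΓ ((Representation.isSmooth_smoothInd H σ).comp ι hι) S hS lam hlam
    ⟨f, hf⟩ hint

end Functional

/-! ### The measure-free form: an indicator cell function on a non-empty compact open set -/

section Indicator

variable {G : Type*} [Group G] [TopologicalSpace G] [IsTopologicalGroup G] (H : Subgroup G)
  {W : Type*} [NormedAddCommGroup W] [NormedSpace ℂ W] [CompleteSpace W] (σ : Representation ℂ H W)
  {Γ : Type*} [Group Γ] [TopologicalSpace Γ] [IsTopologicalGroup Γ] (ι : Γ →* G) (w₀ : G)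

/-- a limit of compact open subgroups carries a RIGHT Haar measure: a right-invariant measure, finite on compacts and positive
on non-empty open sets (Mathlib's `haarMeasure` at a compact open subgroup, composed with inversion). [cite: BernsteinZelevinsky1977, §1.9 («`U` is the union of its compact open subgroups»)] -/
theorem exists_isMulRightInvariant_of_isLimitOfCompactOpen [MeasurableSpace Γ] [BorelSpace Γ]
    (hΓ : IsLimitOfCompactOpen Γ) :
    ∃ μ : Measure Γ, IsFiniteMeasureOnCompacts μ ∧ μ.IsOpenPosMeasure ∧ μ.IsMulRightInvariant := by
  obtain ⟨K, hKo, hKc, -⟩ := hΓ {1} isCompact_singleton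
  let K₀ : TopologicalSpace.PositiveCompacts Γ :=
    ⟨⟨(K : Set Γ), hKc⟩, by rw [hKo.interior_eq]; exact ⟨1, K.one_mem⟩⟩
  exact ⟨(Measure.haarMeasure K₀).inv, inferInstance, inferInstance, inferInstance⟩

/-- **THE OPEN-CELL NON-VANISHING CRITERION, measure-free form**: if the cell function of `f ∈ Ind_H^G σ` at `w₀` along the continuous
`ι : Γ →* G` (`Γ` the union of its compact open subgroups) is `1_K · w` for a NON-EMPTY COMPACT OPEN `K ⊆ Γ` and `w ≠ 0`, then the class
of `f` in the `Γ`-coinvariants of `Ind_H^G σ ∘ ι` is non-zero (`λ(f) = μ(K) · w ≠ 0` for a right Haar measure `μ`) — the standard sections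
of the open Bruhat cell survive in the Jacquet module. [cite: BernsteinZelevinsky1977, §5 (5.2) and Prop. 1.9 (a)] [cite: Casselman1995, §6.3 (proof of Thm. 6.3.5)] -/
theorem SmoothInd.mk_coinvariants_ne_zero_of_cellFun_eq_indicator (hΓ : IsLimitOfCompactOpen Γ) (hι : Continuous ι)
    (f : Representation.SmoothInd H σ) {K : Set Γ} (hKo : IsOpen K) (hKc : IsCompact K) (hKn : K.Nonempty)
    {w : W} (hw : w ≠ 0) (hf : ∀ γ, f.toFun (w₀ * ι γ) = K.indicator (fun _ => w) γ) :
    Representation.Coinvariants.mk ((Representation.smoothIndRep H σ).comp ι) f ≠ 0 := by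
  borelize Γ
  obtain ⟨μ, hμc, hμo, hμr⟩ := exists_isMulRightInvariant_of_isLimitOfCompactOpen (Γ := Γ) hΓ
  have hcell : (fun γ => f.toFun (w₀ * ι γ)) = K.indicator (fun _ => w) := funext hf
  have hsupp : HasCompactSupport fun γ => f.toFun (w₀ * ι γ) := by
    rw [hcell]
    exact HasCompactSupport.of_support_subset_isCompact hKc (Set.support_indicator_subset)
  refine SmoothInd.mk_coinvariants_ne_zero_of_integral_cellFun_ne_zero H σ ι w₀ μ hΓ hι f hsupp ?_
  rw [hcell, integral_indicator_const w hKo.measurableSet, smul_ne_zero_iff]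
  refine ⟨?_, hw⟩
  rw [Measure.real, ENNReal.toReal_ne_zero]
  exact ⟨hμo.open_pos K hKo hKn, (hKc.measure_lt_top (μ := μ)).ne⟩

end Indicator

/-! ## §4 On the Jacquet module of a parabolic triple `t = (P, M, N)`: `Γ = N`, `ι` the inclusion -/

section ParabolicAlg

variable {G : Type*} [Group G] (t : ParabolicTriple G)

/-- **the relation submodule of the Jacquet module does not depend on how `N` is presented**: the span of the `ρ n v − v`, `n ∈ N ≤ P`
viewed in `P` (★ `ParabolicTriple.restrict`, the Jacquet-module carrier), equals the span over `n ∈ N ≤ G` (`ρ ∘ N.subtype`). [cite: BernsteinZelevinsky1977, §1.8] -/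
theorem ParabolicTriple.ker_restrict_eq_ker_comp_subtype {k V : Type*} [CommRing k] [AddCommGroup V] [Module k V]
    (ρ : Representation k G V) :
    Representation.Coinvariants.ker (t.restrict ρ) = Representation.Coinvariants.ker (ρ.comp t.N.subtype) := by
  apply le_antisymm
  · refine Submodule.span_le.2 ?_
    rintro _ ⟨⟨n, v⟩, rfl⟩
    exact Representation.Coinvariants.sub_mem_ker (ρ := ρ.comp t.N.subtype)
      ⟨((n : t.P) : G), Subgroup.mem_subgroupOf.1 n.2⟩ v
  · refine Submodule.span_le.2 ?_
    rintro _ ⟨⟨n, v⟩, rfl⟩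
    exact Representation.Coinvariants.sub_mem_ker (ρ := t.restrict ρ)
      ⟨⟨(n : G), t.N_le n.2⟩, Subgroup.mem_subgroupOf.2 n.2⟩ v

/-- hence: zero class in the Jacquet-module carrier `(t.restrict ρ).Coinvariants` iff zero class in the `N`-coinvariants of `ρ ∘ N.subtype`.
[cite: BernsteinZelevinsky1977, §1.8] -/
theorem ParabolicTriple.mk_restrict_eq_zero_iff {k V : Type*} [CommRing k] [AddCommGroup V] [Module k V]
    (ρ : Representation k G V) (v : V) :
    Representation.Coinvariants.mk (t.restrict ρ) v = 0 ↔ Representation.Coinvariants.mk (ρ.comp t.N.subtype) v = 0 := by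
  rw [Representation.Coinvariants.mk_eq_zero, Representation.Coinvariants.mk_eq_zero,
    ParabolicTriple.ker_restrict_eq_ker_comp_subtype]

end ParabolicAlg

section Parabolic

variable {G : Type*} [Group G] [TopologicalSpace G] [IsTopologicalGroup G] (t : ParabolicTriple G)
  {W : Type*} [NormedAddCommGroup W] [NormedSpace ℂ W] [CompleteSpace W]

/-- **Open-cell non-vanishing in the Jacquet module `r_P (Ind_P^G σ')`**: if `N` is the union of its compact open subgroups
and the cell function `n ↦ f (w₀ n)` of `f ∈ Ind_P^G σ'` is `1_K · w` for a non-empty compact open `K ⊆ N` and `w ≠ 0`,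
then `[f] ≠ 0` in the Jacquet-module carrier `(t.restrict (Ind_P^G σ')).Coinvariants`. [cite: BernsteinZelevinsky1977, Geometrical Lemma 2.12 and §5 (5.2)]
[cite: Casselman1995, §6.3 (proof of Thm. 6.3.5)] -/
theorem ParabolicTriple.mk_restrict_smoothIndRep_ne_zero_of_cellFun_eq_indicator
    (hN : IsLimitOfCompactOpen t.N) (σ' : Representation ℂ t.P W) (w₀ : G)
    (f : Representation.SmoothInd t.P σ') {K : Set t.N} (hKo : IsOpen K) (hKc : IsCompact K) (hKn : K.Nonempty)
    {w : W} (hw : w ≠ 0) (hf : ∀ n : t.N, f.toFun (w₀ * n) = K.indicator (fun _ => w) n) :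
    Representation.Coinvariants.mk (t.restrict (Representation.smoothIndRep t.P σ')) f ≠ 0 := by
  rw [Ne, ParabolicTriple.mk_restrict_eq_zero_iff]
  exact SmoothInd.mk_coinvariants_ne_zero_of_cellFun_eq_indicator t.P σ' t.N.subtype w₀ hN continuous_subtype_val
    f hKo hKc hKn hw hf

/-- the same for NORMALISED induction `i_P^G σ = Ind_P^G (σ ∘ proj ⊗ δ_P^{1/2})` (★ `Representation.normalizedInd`), on the carrier of ★
`Representation.normalizedJacquet` ∕ ★ `jacquetModule`. [cite: BernsteinZelevinsky1977, §2.3 and Geometrical Lemma 2.12] [cite: Casselman1995, Lemma 7.1.1 (a)] -/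
theorem ParabolicTriple.mk_restrict_normalizedInd_ne_zero_of_cellFun_eq_indicator [LocallyCompactSpace t.P]
    (hN : IsLimitOfCompactOpen t.N) (σ : Representation ℂ t.M W) (w₀ : G)
    (f : Representation.SmoothInd t.P (Representation.twist (σ.comp t.proj) (rootDeltaChar t.P)))
    {K : Set t.N} (hKo : IsOpen K) (hKc : IsCompact K) (hKn : K.Nonempty)
    {w : W} (hw : w ≠ 0) (hf : ∀ n : t.N, f.toFun (w₀ * n) = K.indicator (fun _ => w) n) :
    Representation.Coinvariants.mk (t.restrict (Representation.normalizedInd t σ)) f ≠ 0 :=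
  ParabolicTriple.mk_restrict_smoothIndRep_ne_zero_of_cellFun_eq_indicator t hN _ w₀ f hKo hKc hKn hw hf

end Parabolic

/-! ## §5 The CM instance: the Borel of `U(Φ_N)(L⁺_v)` and ★ `cmPrincipalSeries` -/

namespace UnitaryGroup

open _root_.NumberField _root_.IsDedekindDomain

variable (L : Type) [Field L] [NumberField L] [IsCMField L]

set_option synthInstance.maxHeartbeats 400000 in
set_option maxHeartbeats 1600000 in
/-- **Open-cell non-vanishing in the Jacquet module of the principal series of `U(Φ_N)(L⁺_v)`** (★ `cmPrincipalSeries`, ★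
`cmBorelTriple`): if `f ∈ i_G(χ)` has cell function `n ↦ f (w₀ n) = 1_K(n) · w` on the unipotent subgroup `N` for a non-empty
compact open `K ⊆ N(L⁺_v)` and `w ≠ 0`, then `[f] ≠ 0` in `(i_G χ)_N`.  The `N`-hypothesis of §4 is ★
`isLimitOfCompactOpen_cmBorelTriple_N`.  (Node N1 of the F0∕P3 statement tree, lower-bound half: the open cell contributes a
non-zero line to `r_B i_G(χ)` — [Casselman1995, Lemma 7.1.1 (a)].) [cite: Casselman1995, Lemma 7.1.1 (a) and §6.3] [cite: BernsteinZelevinsky1977, Geometrical Lemma 2.12] -/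
theorem mk_restrict_cmPrincipalSeries_ne_zero_of_cellFun_eq_indicator (N : ℕ)
    (v : HeightOneSpectrum (𝓞 ↥(maximalRealSubfield L)))
    (χ : ↥(torusU (conjLocal L (IsCMField.complexConj L) v) (cmLocalForm L N v)) →* ℂˣ)
    (w₀ : ↥(unitaryGroupOfForm (conjLocal L (IsCMField.complexConj L) v) (cmLocalForm L N v)))
    {K : Set ↥(cmBorelTriple L N v).N} (hKo : IsOpen K) (hKc : IsCompact K) (hKn : K.Nonempty) {w : ℂ} (hw : w ≠ 0) :
    haveI := locallyCompactSpace_cmBorelU L N v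
    ∀ (f : Representation.SmoothInd (cmBorelTriple L N v).P
      (Representation.twist
        (((Representation.trivial ℂ ↥(torusU (conjLocal L (IsCMField.complexConj L) v) (cmLocalForm L N v)) ℂ).twist
          χ).comp (cmBorelTriple L N v).proj) (rootDeltaChar (cmBorelTriple L N v).P))),
      (∀ n : ↥(cmBorelTriple L N v).N, f.toFun (w₀ * n) = K.indicator (fun _ => w) n) →
        Representation.Coinvariants.mk ((cmBorelTriple L N v).restrict (cmPrincipalSeries L N v χ)) f ≠ 0 := by
  haveI := locallyCompactSpace_cmBorelU L N v
  intro f hf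
  exact ParabolicTriple.mk_restrict_normalizedInd_ne_zero_of_cellFun_eq_indicator (cmBorelTriple L N v)
    (isLimitOfCompactOpen_cmBorelTriple_N L N v) _ w₀ f hKo hKc hKn hw hf

end UnitaryGroup

end Literature.NumberTheory.Automorphic

end
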